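import Summits.FinalStateConjecture.FinalStateConjecture.Theorems.StarvedNecksNeckGapDecayOfCoreGlue
import Summits.FinalStateConjecture.FinalStateConjecture.Theorems.StarvedNecksNeckGapDecayStubSubwallClosureOfNoEscape
import Summits.FinalStateConjecture.FinalStateConjecture.Theorems.StarvedNecksNeckGapDecayStubOrientationAnchor
import Summits.FinalStateConjecture.FinalStateConjecture.Theorems.StarvedNecksNeckGapDecayStubNoLateEscape
import Summits.FinalStateConjecture.FinalStateConjecture.Theorems.StarvedNecksNeckGapDecayStubNearIdInjOpen
import Summits.FinalStateConjecture.FinalStateConjecture.Theorems.StarvedNecksNeckGapDecayStubBilinPullbackNearIdConst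
import Summits.FinalStateConjecture.FinalStateConjecture.Theorems.StarvedNecksNeckGapDecayStubMovingShellCutoff
import Literature.Uncategorized.OrientationAnchor
import Literature.Uncategorized.SubwallClosureOfNoEscape
import Literature.Uncategorized.HonestCore
import Literature.Uncategorized.LateEscape
import HarnessLib

/-!
# `NeckGapDecay` from its physics core (crux `StarvedNecks.NeckGapDecay`, stmt-FinalStateConjecture-16768,
# line `Sketch`; `--supports`)

The REDUCTION of the crux to ONE analytic statement, kernel-checked in the tree (continuation lead c3; it is the
composition `NeckGapDecay_of` of the line skeleton `Cruxes/NeckGapDecay/Lines/Sketch.lean` v8, leads 0/c1, with the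
physics stub restated WITHOUT its three theorem-antecedents M1/F/W4 and without the derived `OrientationAnchor`
hypothesis — all four are theorems of the tree and are discharged here or available to any prover of the core):

  `neckGapDecay_of_gapCoreHolds : GapCoreHolds → <body of Theses.StarvedNecks.NeckGapDecay, verbatim>`.

`GapCoreHolds` (P-core) is the crux's deciding physics in its leanest packaged form: for every admissible datum, MGHD,
honest `C⁴` decomposition (`HonestCore`, `HonestFar`, pairwise distinct hole velocities) of `O = exteriorOf 𝒟 d.charted`
and every hole `i` whose INPUT chart is not already `C²`-certified below some normalised dominating wall, SOME normalised
dominating wall `W` and a gap CORE certificate `GapCoreCert` (landed predicate, `…CertOfCoreStub`): a chart of the ANNULAR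
late tube beyond a receding seam sphere inside the input chart's certified zone, matched to the input chart to third order
across the seam collar, `C²`-certified beyond the seam out to the wall, far annulus separated from the input chart's inner
image.  Mathematically: rate-free `C²` decay of the vacuum metric, in a constructed gauge, on the intermediate zone
`{R_g(τ) < rᵢ ≤ ρᵢ(x⁰) + 1}` between the fixed-radius-certified near zone and the flat-certified radiation zone, where the
input gives only `C⁰` control (`HonestFar`(3)).  No printed theorem instantiates it (nearest: Klainerman–Rodnianski 2007
Kirchhoff–Sobolev parametrix; Luk–Oh arXiv:2404.02220 §1.2.4; Christodoulou–Klainerman 1993 / Klainerman–Nicolò 2003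
far-zone transport; Shen arXiv:2303.12758 Thm 1.6/1.7 and Caciotta–Nicolò 2010 external regions WITHOUT inner interface).

PROOF of the reduction (all ingredients landed): P-glue `stub_certOfCoreFrom` (p154994) with the bricks W1–W3
(p147361, p151188, p149579) turns the core certificate into a `GapAnalyticCert`; a SELF-CERTIFIED input needs no physics
(`OfCoreGlue.cert_of_selfCertified`); (G3) ⇒ quantitative `C⁰` clause (`eventually_c0_le`); S4b `stub_noLateEscape`
(p142898) ⇒ a time without late escape; S4a `stub_subwallClosureOfNoEscape` (p140677) ⇒ (G5); S2 `stub_orientationAnchor`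
(p142387) anchors the input chart at radius `R₁ + 1`; (G4) = `OfCoreGlue.g4_of_anchor` (S3a p139651 + cone algebra);
(G1) restricted by `g1_mono`; the wall clause from the core's threshold.  The statement of the theorem is the crux decl's
body VERBATIM (Theses-free, so that a closing file can import this one).

Definitions introduced (Summit-level, verbatim the skeleton's): `HonestFar` (= the crux's `Hf`), `DistinctVelocities`,
`GapCoreHolds`.  References: DHRT arXiv:2104.08222 §1; O'Neill 1983 Ch. 5, 14; Klainerman–Rodnianski, J. Hyperbolic
Differ. Equ. 4 (2007); Luk–Oh arXiv:2404.02220.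
-/

noncomputable section

open scoped Manifold ContDiff Topology ENNReal
open Filter Set Topology Literature.Geometry.Lorentzian Literature.Uncategorized

namespace Summit.FinalStateConjecture.FinalStateConjecture.Theorems.NeckGapDecay.ConnectionLevelCones.OfCore

open Summit.FinalStateConjecture.FinalStateConjecture.Theorems.NeckGapDecay.ConnectionLevelCones.CertOfCoreStub
  (GapAnalyticCert GapCoreCert CertOfCore CertOfCoreFrom stub_certOfCoreFrom)
open Summit.FinalStateConjecture.FinalStateConjecture.Theorems.NeckGapDecay.ConnectionLevelCones.OfCoreGlue

-- the problem namespace `Summit.FinalStateConjecture.FinalStateConjecture` repeats the summit name by design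
set_option linter.dupNamespace false
-- instance search through nested operator types `E4 →L[ℝ] E4 →L[ℝ] ℝ`
set_option maxSynthPendingDepth 3

/-! ## The crux's hypothesis bundles, named (verbatim the crux text; `HonestCore` = `Hc` is `Literature.Uncategorized.HonestCore`) -/

/-- `HonestFar 𝓢 O k d R₀` = the crux's `Hf` (verbatim): flat-late points lie below later flat slabs; closures of far flat
slabs are flat points; eventually each hole chart is `C⁰`-honest (`1/(10‖Λᵢ‖²)`) on its own coordinate Voronoi cell beyond
`R₀`.  DHRT arXiv:2104.08222, §1 (deviation norms). -/
def HonestFar (𝓢 : Spacetime.{0} 4) (O : Set 𝓢.carrier) (k : ℕ) (d : FinalStateDecomposition 𝓢 O k)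
    (R₀ : ℝ) : Prop :=
  let B := d.background; let t := fun i ↦ (B i).time; let r := fun i ↦ (B i).radius; let Φ := d.flatChart;
  (∀ τ₂ : ℝ, d.τ₀ < τ₂ → Φ '' {y | d.τ₀ < y.1 0 ∧ y.1 0 < τ₂} ⊆ 𝓢.metric.causalPast 𝓢.timeOrientation (Φ '' (Minkowski.backgroundOn d.flatDomain).timeSlab τ₂)) ∧
    (∀ τ' : ℝ, d.τ₀ < τ' → closure (Φ '' {y | τ' ≤ y.1 0 ∧ ∀ i, d.excision i (y.1 0) + 1 ≤ r i y.1}) ⊆ Φ '' {y | τ' ≤ y.1 0}) ∧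
    (∀ i, ∃ T : ℝ, supCkENorm (Subtype.val '' {x : (B i).domain | T ≤ t i x.1 ∧ R₀ ≤ r i x.1 ∧ ∀ j, j ≠ i → r i x.1 ≤ r j x.1}) 0 (𝓢.deviationExtend (B i) (d.chart i)) ≤ ENNReal.ofReal (1 / (10 * ‖(((d.motion i).1 : E4 ≃L[ℝ] E4) : E4 →L[ℝ] E4)‖ ^ 2)))

/-- DV: pairwise distinct asymptotic four-velocities `Λᵢe₀ ≠ Λⱼe₀` of the holes (verbatim the crux's antecedent; the
rev-2 repair of the parent crux `NecksCertify`). -/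
def DistinctVelocities {𝓢 : Spacetime.{0} 4} {O : Set 𝓢.carrier} {k : ℕ}
    (d : FinalStateDecomposition 𝓢 O k) : Prop :=
  ∀ i j : Fin d.N, i ≠ j →
    ((d.motion i).1 : E4 ≃L[ℝ] E4) (E4.basisVector 0) ≠ ((d.motion j).1 : E4 ≃L[ℝ] E4) (E4.basisVector 0)

/-! ## P-core, antecedent-free -/

/-- **P-core `GapCoreHolds` — the physics core of `NeckGapDecay`** (the one open statement of the line `Sketch`; the
skeleton's registered `GapCoreCertHolds` with its theorem-antecedents `OscillatoryJacobi → FarFlatTransfer →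
SlowSmoothMinorant →` and the derived hypothesis `OrientationAnchor …` removed — all four are theorems of the tree).
For EVERY admissible datum, maximal vacuum Cauchy development `𝒟`, `C⁴` final-state decomposition `d` of
`O = exteriorOf 𝒟 d.charted` with `HonestCore`, `HonestFar` and pairwise distinct hole velocities, and EVERY hole `i` whose
input chart `Ψᵢ` is NOT self-certified (no normalised wall — continuous, non-decreasing, sublinear, slope
`≤ 1/(10‖Λᵢ‖²)`, `≥ R₀ + 2`, dominating `3ρᵢ + 2` from a threshold — has the `C²` deviation of `Ψᵢ` on its sub-wall slabs
tending to `0`): there are a threshold `T₀` and such a normalised dominating wall `W` with a gap CORE certificate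
`GapCoreCert 𝒟 O d R₀ i T₀ W` — a chart `Ψ'` of the annular late tube beyond a slow receding seam `s = ϱ(t) + 1` inside the
input chart's `C²`-certified zone, `Ψ' = Ψᵢ ∘ T` on the seam collar with `T → id` in `C³`, `C²` deviation from boosted
Kerrᵢ `→ 0` on `{t = τ, ϱ(τ) + 2 ≤ s, r ≤ W(x⁰)}`, far annulus separated from `Ψᵢ`'s image of the inner ball.
Status: OPEN — rate-free `C²` late-time decay of the vacuum metric on the intermediate zone from `C⁰` a-priori control and
data provenance; unprinted even for `N = 1` (see the module docstring for the nearest literature). -/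
def GapCoreHolds : Prop :=
  ∀ (X : Type) [TopologicalSpace X] [ChartedSpace E3 X] [IsManifold (𝓡 3) ∞ X] [ConnectedSpace X]
    (D : InitialDataSet (𝓡 3) X), D ∈ admissibleVacuumData X →
    ∀ 𝒟 : VacuumCauchyDevelopment D, 𝒟.IsMaximal →
    ∀ (O : Set 𝒟.carrier) (d : FinalStateDecomposition 𝒟.toSpacetime O 4) (R₀ : ℝ),
      O = exteriorOf 𝒟.toCauchyDevelopment d.charted →
      HonestCore 𝒟.toSpacetime O 4 d R₀ → HonestFar 𝒟.toSpacetime O 4 d R₀ → DistinctVelocities d →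
      ∀ i : Fin d.N, ¬ (∃ (T₀ : ℝ) (W : ℝ → ℝ), Continuous W ∧ Monotone W ∧ Tendsto (fun s ↦ W s / s) atTop (𝓝 0) ∧
        (∀ s s', s ≤ s' → W s' ≤ W s + 1 / (10 * ‖(((d.motion i).1 : E4 ≃L[ℝ] E4) : E4 →L[ℝ] E4)‖ ^ 2) * (s' - s)) ∧
        (∀ s, R₀ + 2 ≤ W s) ∧ (∀ s, T₀ ≤ s → 3 * d.excision i s + 2 ≤ W s) ∧
        Tendsto (fun τ ↦ supCkENorm (Subtype.val '' {x : (d.background i).domain |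
          (d.background i).time x.1 = τ ∧ (d.background i).radius x.1 ≤ W (x.1 0)}) 2
          (𝒟.toSpacetime.deviationExtend (d.background i) (d.chart i))) atTop (𝓝 0)) →
      ∃ (T₀ : ℝ) (W : ℝ → ℝ), Continuous W ∧ Monotone W ∧ Tendsto (fun s ↦ W s / s) atTop (𝓝 0) ∧
        (∀ s s', s ≤ s' → W s' ≤ W s + 1 / (10 * ‖(((d.motion i).1 : E4 ≃L[ℝ] E4) : E4 →L[ℝ] E4)‖ ^ 2) * (s' - s)) ∧
        (∀ s, R₀ + 2 ≤ W s) ∧ (∀ s, T₀ ≤ s → 3 * d.excision i s + 2 ≤ W s) ∧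
        GapCoreCert 𝒟.toSpacetime O d R₀ i T₀ W

/-! ## The reduction -/

/-- **`NeckGapDecay` from its physics core.**  `GapCoreHolds` implies the crux `Theses.StarvedNecks.NeckGapDecay`, whose
body is the statement below VERBATIM (the gate's probe `example : NeckGapDecay := by exact …` closes by `δ`-unfolding).
Per hole `i`: either the INPUT chart certifies a normalised dominating wall by itself (`cert_of_selfCertified`, structure
only), or P-core + the landed P-glue (`stub_certOfCoreFrom` with W1–W3) give a `GapAnalyticCert` for a wall of the core's
choosing; then (G3) ⇒ quantitative `C⁰` clause, S4b ⇒ no late escape ⇒ (G5) by S4a, S2's anchor at `R₁ + 1` ⇒ (G4) by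
`g4_of_anchor`, (G1) restricted to the final threshold `max τ₂ T + 1` by `g1_mono`.  DHRT arXiv:2104.08222, §1;
O'Neill 1983, Ch. 14. -/
theorem neckGapDecay_of_gapCoreHolds (hcore : GapCoreHolds) :
    open Literature.Geometry.Lorentzian in open scoped ContDiff ENNReal in let Hc:=(fun (𝓢 : Spacetime.{0} 4) (O : Set 𝓢.carrier) (k : ℕ) (d : FinalStateDecomposition 𝓢 O k) (R₀ : ℝ)=>let B:=d.background; let t:=fun i↦(B i).time; let r:=fun i↦(B i).radius; let Ψ:=d.chart; (∀ i, Kerr.IsSubextremal (d.mass i) (d.spin i) ∧ 100 * d.mass i ≤ R₀ ∧ 0 < ((d.motion i).1 : E4 ≃L[ℝ] E4) (E4.basisVector 0) 0) ∧ (∀ i (ϱ τ₂ : ℝ), R₀ ≤ ϱ → d.τ₀ < τ₂ → Ψ i '' {x | d.τ₀ < t i x.1 ∧ t i x.1 < τ₂ ∧ r i x.1 < ϱ} ⊆ 𝓢.metric.causalPast 𝓢.timeOrientation (Ψ i '' (B i).truncTimeSlab ϱ τ₂)) ∧ (∀ i (τ' : ℝ) (ϱ : ℝ → ℝ), Continuous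 ϱ → d.τ₀ < τ' → let A:=Ψ i '' {x | τ' ≤ t i x.1 ∧ r i x.1 ≤ ϱ (t i x.1)}; closure A ∩ O ⊆ A) ∧ (∀ y : d.flatDomain, d.τ₀ < y.1 0 → 𝓢.timeOrientation.IsFutureDirected (mfderiv 𝓘(ℝ, E4) (𝓡 4) d.flatChart y (E4.basisVector 0)))); let Hf:=(fun (𝓢 : Spacetime.{0} 4) (O : Set 𝓢.carrier) (k : ℕ) (d : FinalStateDecomposition 𝓢 O k) (R₀ : ℝ)=>let B:=d.background; let t:=fun i↦(B i).time; let r:=fun i↦(B i).radius; let Φ:=d.flatChart; (∀ τ₂ : ℝ, d.τ₀ < τ₂ → Φ '' {y | d.τ₀ < y.1 0 ∧ y.1 0 < τ₂} ⊆ 𝓢.metric.causalPast 𝓢.timeOrientation (Φ '' (Minkowski.backgroundOn d.flatDomain).timeSlab τ₂)) ∧ (∀ τ' : ℝ, d.τ₀ < τ' → closure (Φ '' {y | τ' ≤ y.1 0 ∧ ∀ i, d.excision i (y.1 0) + 1 ≤ r i y.1}) ⊆ Φ '' {y | τ' ≤ y.1 0}) ∧ (∀ i, ∃ T : ℝ,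 supCkENorm (Subtype.val '' {x : (B i).domain | T ≤ t i x.1 ∧ R₀ ≤ r i x.1 ∧ ∀ j, j ≠ i → r i x.1 ≤ r j x.1}) 0 (𝓢.deviationExtend (B i) (d.chart i)) ≤ ENNReal.ofReal (1 / (10 * ‖(((d.motion i).1 : E4 ≃L[ℝ] E4) : E4 →L[ℝ] E4)‖ ^ 2)))); ∀ (X : Type) [TopologicalSpace X] [ChartedSpace E3 X] [IsManifold (𝓡 3) ∞ X] [ConnectedSpace X] (D : InitialDataSet (𝓡 3) X), D ∈ admissibleVacuumData X → ∀ 𝒟 : VacuumCauchyDevelopment D, 𝒟.IsMaximal → ∀ (O : Set 𝒟.carrier) (d : FinalStateDecomposition 𝒟.toSpacetime O 4) (R₀ : ℝ), O = exteriorOf 𝒟.toCauchyDevelopment d.charted → Hc 𝒟.toSpacetime O 4 d R₀ → Hf 𝒟.toSpacetime O 4 d R₀ → (∀ i j : Fin d.N, i ≠ j → ((d.motion i).1 : E4 ≃L[ℝ] E4) (E4.basisVector 0) ≠ ((d.motion j).1 : E4 ≃L[ℝ] E4) (E4.basisVector 0)) → ∀ i : Fin d.N, ∃ (R₁ τ₁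 : ℝ) (W : ℝ → ℝ) (Ψg : (d.background i).domain → 𝒟.carrier), let B:=d.background i; let t:=B.time; let r:=B.radius; R₀ ≤ R₁ ∧ d.τ₀ ≤ τ₁ ∧ Continuous W ∧ (∀ s, τ₁ ≤ s → 3 * d.excision i s + 2 ≤ W s) ∧ (let U : Set B.domain := {x | τ₁ < t x.1 ∧ r x.1 < W (x.1 0) + 1}; ContMDiffOn 𝓘(ℝ, E4) (𝓡 4) ∞ Ψg U ∧ Topology.IsOpenEmbedding (U.restrict Ψg) ∧ Ψg '' U ⊆ d.charted) ∧ (∀ x : B.domain, r x.1 ≤ R₁ + 1 → Ψg x = d.chart i x) ∧ Tendsto (fun τ ↦ supCkENorm (Subtype.val '' {x : B.domain | t x.1 = τ ∧ r x.1 ≤ W (x.1 0)}) 2 (𝒟.toSpacetime.deviationExtend B Ψg)) atTop (𝓝 0) ∧ (∀ x : B.domain, τ₁ ≤ t x.1 → R₁ ≤ r x.1 → r x.1 ≤ W (x.1 0) → 𝒟.toSpacetime.timeOrientation.IsFutureDirected (mfderiv 𝓘(ℝ, E4) (𝓡 4) Ψg x (((d.motion i).1 : E4 ≃L[ℝ]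 E4) (E4.basisVector 0)))) ∧ (∀ (τ' : ℝ) (ϱ : ℝ → ℝ), Continuous ϱ → τ₁ < τ' → (∀ x : B.domain, τ' ≤ t x.1 → r x.1 ≤ ϱ (t x.1) → r x.1 ≤ W (x.1 0)) → closure (Ψg '' {x | τ' ≤ t x.1 ∧ r x.1 ≤ ϱ (t x.1)}) ∩ O ⊆ Ψg '' {x | τ' ≤ t x.1 ∧ r x.1 ≤ ϱ (t x.1)}) := by
  have hW1 : NearIdInjOpen := NearIdInjOpenStub.stub_nearIdInjOpen
  have hW2 : BilinPullbackNearIdConst := BilinPullbackNearIdConstStub.stub_bilinPullbackNearIdConst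
  have hW3 : MovingShellCutoff := MovingShellCutoffStub.stub_movingShellCutoff
  have hS4b := NoLateEscapeStub.stub_noLateEscape
  have hS2 := OrientationAnchorStub.stub_orientationAnchor
  have hS3a : Literature.Geometry.Lorentzian.BandAnchoredPaths := BandAnchoredPathsStub.stub_bandAnchoredPaths
  have hS4a : SubwallClosureOfNoEscape := SubwallClosureStub.stub_subwallClosureOfNoEscape
  intro Hc Hf X _ _ _ _ D hD 𝒟 h𝒟 O d R₀ hO hc hf hdv i
  have hf' : HonestFar 𝒟.toSpacetime O 4 d R₀ := hf
  have hanchor : OrientationAnchor 𝒟.toSpacetime O 4 d R₀ := hS2 X D hD 𝒟 h𝒟 O d R₀ hO hc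
  have hc' : HonestCore 𝒟.toSpacetime O 4 d R₀ := hc
  obtain ⟨hc1, hc2, hc3, hc4⟩ := hc'
  have hKpos : 0 < ‖(((d.motion i).1 : E4 ≃L[ℝ] E4) : E4 →L[ℝ] E4)‖ :=
    one_pos.trans_le (BoostedKerrLegs.one_le_norm_lorentz (d.motion i).1)
  have hMR : 100 * d.mass i ≤ R₀ := (hc1 i).2.1
  -- either the INPUT chart certifies a normalised dominating wall by itself (no physics), or P-core re-gauges the gap
  have hcert : ∃ (T₀ : ℝ) (W : ℝ → ℝ), Continuous W ∧ Monotone W ∧ Tendsto (fun s ↦ W s / s) atTop (𝓝 0) ∧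
      (∀ s s', s ≤ s' → W s' ≤ W s + 1 / (10 * ‖(((d.motion i).1 : E4 ≃L[ℝ] E4) : E4 →L[ℝ] E4)‖ ^ 2) * (s' - s)) ∧
      (∀ s, R₀ + 2 ≤ W s) ∧ (∀ s, T₀ ≤ s → 3 * d.excision i s + 2 ≤ W s) ∧
      GapAnalyticCert 𝒟.toSpacetime O d R₀ i T₀ W := by
    by_cases hself : (∃ (T₀ : ℝ) (W : ℝ → ℝ), Continuous W ∧ Monotone W ∧ Tendsto (fun s ↦ W s / s) atTop (𝓝 0) ∧
      (∀ s s', s ≤ s' → W s' ≤ W s + 1 / (10 * ‖(((d.motion i).1 : E4 ≃L[ℝ] E4) : E4 →L[ℝ] E4)‖ ^ 2) * (s' - s)) ∧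
      (∀ s, R₀ + 2 ≤ W s) ∧ (∀ s, T₀ ≤ s → 3 * d.excision i s + 2 ≤ W s) ∧
      Tendsto (fun τ ↦ supCkENorm (Subtype.val '' {x : (d.background i).domain |
        (d.background i).time x.1 = τ ∧ (d.background i).radius x.1 ≤ W (x.1 0)}) 2
        (𝒟.toSpacetime.deviationExtend (d.background i) (d.chart i))) atTop (𝓝 0))
    · obtain ⟨T₀, W, hWc, hWm, hWs, hWl, hWR, hWall, hG3⟩ := hself
      exact ⟨T₀, W, hWc, hWm, hWs, hWl, hWR, hWall, cert_of_selfCertified d R₀ i hWc hG3⟩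
    · obtain ⟨T₀, W, hWc, hWm, hWs, hWl, hWR, hWall, hcoreCert⟩ :=
        hcore X D hD 𝒟 h𝒟 O d R₀ hO hc hf' hdv i hself
      exact ⟨T₀, W, hWc, hWm, hWs, hWl, hWR, hWall,
        stub_certOfCoreFrom hW1 hW2 hW3 𝒟.toSpacetime O d R₀ i T₀ W hMR hWc hcoreCert⟩
  obtain ⟨T₀, W, hWc, hWm, hWs, hWl, hWR, hWall, R₁, τ₁, Ψg, hR₁, hτ₁, hG1, hG2, hG3⟩ := hcert
  -- the quantitative `C⁰` clause from (G3)
  have hcpos : 0 < 1 / (20 * ‖(((d.motion i).1 : E4 ≃L[ℝ] E4) : E4 →L[ℝ] E4)‖ ^ 2) := by positivity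
  obtain ⟨τq, hτq⟩ := eventually_c0_le d i W Ψg hG3 hcpos
  -- restrict (G1) to `τ₁' := max τ₁ τq` and get a time without late escape (S4b)
  have h11' : τ₁ ≤ max τ₁ τq := le_max_left _ _
  have hq1' : τq ≤ max τ₁ τq := le_max_right _ _
  have hτ₀1 : d.τ₀ ≤ τ₁ := (le_max_left _ _).trans hτ₁
  have hT₀1 : T₀ ≤ τ₁ := (le_max_right _ _).trans hτ₁
  have hG1' := g1_mono d i h11' hWc Ψg hG1
  obtain ⟨τ₂, h1'2, hnoesc⟩ :=
    hS4b X D 𝒟 O d R₀ hO hc hanchor i R₁ (max τ₁ τq) W Ψg hR₁ (hτ₀1.trans h11') hWc hWm hWs hWl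
      hG1' hG2 (fun τ hτ ↦ hτq τ (hq1'.trans hτ))
  -- the anchor of the input chart at radius `R₁ + 1`
  obtain ⟨T, hT⟩ := hanchor i (R₁ + 1)
  have h2s : τ₂ ≤ max τ₂ T + 1 := by linarith [le_max_left τ₂ T]
  have hTs : T ≤ max τ₂ T + 1 := by linarith [le_max_right τ₂ T]
  have h1s : τ₁ < max τ₂ T + 1 := by linarith [le_max_left τ₂ T]
  have hqs : τq ≤ max τ₂ T + 1 := hq1'.trans (h1'2.trans h2s)
  refine ⟨R₁, max τ₂ T + 1, W, Ψg, hR₁, hτ₀1.trans h1s.le, hWc, ?_, g1_mono d i h1s.le hWc Ψg hG1, hG2, hG3, ?_, ?_⟩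
  · -- the wall clause
    intro s hs
    exact hWall s (hT₀1.trans (h1s.le.trans hs))
  · -- (G4)
    exact g4_of_anchor hS3a d i (hc1 i).2.1 (hc1 i).2.2 hR₁ hWc hWm Ψg hG1.1 hG2 hτq hT h1s hqs hTs
  · -- (G5)
    intro τ' ϱ hϱ hτ' hsub
    exact hS4a X D 𝒟 O d R₀ hc i R₁ (max τ₁ τq) W Ψg hR₁ (hτ₀1.trans h11') hWc hG1' hG2 τ₂ h1'2
      hnoesc τ' ϱ hϱ (lt_of_le_of_lt h2s hτ') hsub

end Summit.FinalStateConjecture.FinalStateConjecture.Theorems.NeckGapDecay.ConnectionLevelCones.OfCore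

end
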